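import Mathlib
import Literature.Analysis.Calculus.ParametricIntegralCurryJets   -- ★ `contDiff_integral_of_support` (smoothness of compactly supported parametric integrals)
import HarnessLib

/-!
# Shell-null radial profiles: a smooth compactly supported `β` with `β(0) > 0` whose three-dimensional radial shell integrals
# `∫_{ℂ×ℝ} β(σ + |x|² + t²)` vanish for every `0 ≤ σ < ε`

Topic `Analysis/SpecialFunctions`; namespace `Literature.Analysis.SpecialFunctions`.  THEOREMS ONLY (no `def`, no instance, no notation, no axiom, no `sorry`).
Cell `pub/hodgecm-mathlib`, crux H413 (`stmt-HodgeConjecture-24833`), half-A line LH2, road «N8-INNER», brick (10)(B) «CORNER EP GENERATOR, ONE PLACE» of the road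
owner LH2-plan (g1) (RULING (10)′ 2026-09-02T15:59:16Z; SIGSHEET (B) v2 3cdc6cba8e426222, F0P3a-p08 (g25)), FILE P (tree-free real analysis).  Consumer: FILE C
`Rogawski1990/ArchRankTwoCayleyFibreIntegral` (the fibre integral of a radial Cayley bump over the Heisenberg group is `Jac⁻¹ · ∫_{ℂ×ℝ} β(ρ + 2|x|² + y²)`), FILE B
`Rogawski1990/ArchRankTwoCentralGenerator` (the split-chart reading of the corner generator vanishes identically near the corner).  Count-neutral; pays no organ by itself.

THE MATHEMATICS.  (P1) Planar radial integrals are EXACT: for continuous `g` vanishing on `[R, ∞)`,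
`∫_ℂ g(σ + |x|²) dx = π ∫_σ^∞ g(u) du` (polar coordinates: `2π ∫₀^∞ g(σ + r²) r dr`, `u = σ + r²`).  Hence (P2) `∫_{ℂ×ℝ} g(σ + |x|² + t²) = π ∫_ℝ ∫_{σ+t²}^∞ g`, and for a
derivative `g = G′` with `G` vanishing at `+∞`, `∫_{σ+t²}^∞ G′ = −G(σ + t²)`.  (P3) SHELL-NULL PROFILES: fix `0 < ε < R` and a bump `Φ₀ ∈ C_c^∞((ε, R))`, `Φ₀ ≥ 0`, `Φ₀(c₀) = 1`;
put **`β(u) := ∫_ℝ Φ₀″(u + v²) dv`** (with a harmless cut-off in `v` making the support bookkeeping literal).  Then `β ∈ C^∞_c(ℝ)`, `β(u) = 0` for `u ≥ R`, and by (P2) twice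
`∫_{ℂ×ℝ} β(σ + |x|² + t²) = ∫_v ∫_{ℂ×ℝ} Φ₀″((σ+v²) + |x|² + t²) = −π ∫_{ℝ²} Φ₀′(σ + v² + t²) = −π · π ∫_σ^∞ Φ₀′ = π² Φ₀(σ) = 0` for every `σ < ε`; and
`β(0) = ∫_ℝ Φ₀″(v²) dv = ¾ ∫_ℝ Φ₀(v²) v⁻⁴ dv > 0` (on `v ≠ 0`, `Φ₀″(v²) = (d∕dv)[Φ₀′(v²)∕(2v) + Φ₀(v²)∕(4v³)] + ¾ Φ₀(v²)∕v⁴`).  This is the `W_{1∕2} ∘ W_{1∕2} = π W_1`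
semigroup law of the Weyl fractional integral in elementary dress [SamkoKilbasMarichev1993, §2.3 (2.21), §5.1]; the planar identity is [folklore] (Gaussian-integral trick).
USE (FILE C∕B): for an `Ad(K∞)`-invariant radial Cayley bump on `U(2,1)` with profile `β`, Harish-Chandra's fibre integral over `N` at the split torus point `τ(c)` is
`Jac(c)⁻¹ · ∫_{ℂ×ℝ} β(ρ(c) + 2|x|² + y²)`, which (P3) kills for `ρ(c) < ε` — the EXACT vanishing of the split-chart orbital reading near the scalar corner.
HONEST LABEL: HC_CM is proved only modulo the 7 printed citations (2 remaining: hLiu418 = `stmt-HodgeConjecture-24832`, h413 = `stmt-HodgeConjecture-24833`) until rung 0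
closes; pure real analysis, count-neutral (+0∕+0).

* §1 `integrableOn_Ici_of_eq_zero_of_le`, **`integral_comp_add_sq_norm_complex`** (P1), `integral_comp_add_sq_add_sq_real_prod` (P1 on `ℝ × ℝ`),
  **`integral_comp_add_sq_norm_add_sq`** (P2), `integral_Ioi_deriv_eq_neg_of_eq_zero_of_le`, `integral_comp_add_sq_norm_add_sq_deriv` (P2 for a derivative).
* §2 **`exists_contDiff_shellNullProfile`** (P3).

## References
* [SamkoKilbasMarichev1993] S. G. Samko, A. A. Kilbas, O. I. Marichev, *Fractional Integrals and Derivatives* (Gordon and Breach, 1993), §2.3 formula (2.21) (semigroup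
  property of the Riemann–Liouville∕Weyl fractional integrals), §5.1.
* [Helgason2000] S. Helgason, *Groups and Geometric Analysis* (AMS, 2000), Ch. I §2 (radial integration; the Abel transform on rank one).
-/

set_option autoImplicit false

noncomputable section

open MeasureTheory Set Filter Real Topology Metric
open scoped ContDiff

namespace Literature.Analysis.SpecialFunctions

/-! ## §1 Planar radial integrals are exact -/

section Planar

/-- A continuous function vanishing on `[R, ∞)` is integrable on every `[a, ∞)`. [folklore] -/
private theorem integrableOn_Ici_of_eq_zero_of_le {g : ℝ → ℝ} (hg : Continuous g) {R : ℝ} (hgR : ∀ u, R ≤ u → g u = 0) (a : ℝ) :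
    IntegrableOn g (Ici a) := by
  have h1 : IntegrableOn g (Icc a (max a R)) := hg.continuousOn.integrableOn_compact isCompact_Icc
  have h2 : IntegrableOn g (Ici (max a R)) := by
    refine (integrableOn_congr_fun (fun u hu => hgR u ((le_max_right a R).trans hu)) measurableSet_Ici).2 ?_
    exact integrableOn_zero
  rw [← Icc_union_Ici_eq_Ici (le_max_left a R)]
  exact h1.union h2

/-- **(P1) PLANAR RADIAL INTEGRALS ARE EXACT**: `∫_ℂ g(σ + |x|²) dx = π ∫_σ^∞ g` for continuous `g` vanishing on `[R, ∞)` (polar coordinates and `u = σ + r²`). [folklore]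
[cite: Helgason2000, Ch. I §2] -/
theorem integral_comp_add_sq_norm_complex (g : ℝ → ℝ) (hg : Continuous g) {R : ℝ} (hgR : ∀ u, R ≤ u → g u = 0) (σ : ℝ) :
    ∫ x : ℂ, g (σ + ‖x‖ ^ 2) = π * ∫ u in Ioi σ, g u := by
  have h1 := integral_fun_norm_addHaar (volume : Measure ℂ) (fun y : ℝ => g (σ + y ^ 2))
  rw [h1, Complex.finrank_real_complex]
  have hball : (volume : Measure ℂ).real (ball (0 : ℂ) 1) = π := by
    simp [Measure.real, Complex.volume_ball]
  rw [hball]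
  simp only [Nat.add_one_sub_one, pow_one, smul_eq_mul, nsmul_eq_mul, Nat.cast_ofNat]
  -- the substitution `u = σ + y²` on `(0, ∞)`
  have hsub : ∫ y in Ioi (0 : ℝ), (g ∘ fun y : ℝ => σ + y ^ 2) y * (2 * y) = ∫ u in Ioi σ, g u := by
    have h := integral_comp_mul_deriv_Ioi (f := fun y : ℝ => σ + y ^ 2) (f' := fun y : ℝ => 2 * y) (g := g) (a := 0)
      (by fun_prop) (tendsto_atTop_add_const_left _ _ (tendsto_pow_atTop two_ne_zero))
      (fun x _ => (((hasDerivAt_pow 2 x).const_add σ).hasDerivWithinAt.congr_deriv (by push_cast; ring)))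
      hg.continuousOn ?_ ?_
    · simpa using h
    · refine (integrableOn_Ici_of_eq_zero_of_le hg hgR σ).mono_set ?_
      rintro _ ⟨y, -, rfl⟩
      simp only [mem_Ici, le_add_iff_nonneg_right]
      positivity
    · have hc : Continuous fun y : ℝ => (g ∘ fun y : ℝ => σ + y ^ 2) y * (2 * y) := by fun_prop
      refine integrableOn_Ici_of_eq_zero_of_le hc (R := |R - σ| + 1) (fun y hy => ?_) 0
      have hy1 : 1 ≤ y := le_trans (by linarith [abs_nonneg (R - σ)]) hy
      have hy2 : y ≤ y ^ 2 := by nlinarith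
      have hR : R ≤ σ + y ^ 2 := by linarith [le_abs_self (R - σ)]
      simp [Function.comp, hgR _ hR]
  have hlin : ∫ y in Ioi (0 : ℝ), (g ∘ fun y : ℝ => σ + y ^ 2) y * (2 * y) = 2 * ∫ y in Ioi (0 : ℝ), y * g (σ + y ^ 2) := by
    rw [← integral_const_mul]
    refine integral_congr_ae (Filter.Eventually.of_forall fun y => ?_)
    simp only [Function.comp]
    ring
  rw [← hsub, hlin]
  ring

/-- (P1) on `ℝ × ℝ`: `∫_{ℝ²} g(σ + a² + b²) = π ∫_σ^∞ g`. [folklore] [cite: Helgason2000, Ch. I §2] -/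
theorem integral_comp_add_sq_add_sq_real_prod (g : ℝ → ℝ) (hg : Continuous g) {R : ℝ} (hgR : ∀ u, R ≤ u → g u = 0) (σ : ℝ) :
    ∫ z : ℝ × ℝ, g (σ + z.1 ^ 2 + z.2 ^ 2) = π * ∫ u in Ioi σ, g u := by
  rw [← integral_comp_add_sq_norm_complex g hg hgR σ,
    ← (Complex.volume_preserving_equiv_real_prod).integral_comp Complex.measurableEquivRealProd.measurableEmbedding]
  refine integral_congr_ae (Filter.Eventually.of_forall fun x => ?_)
  simp only [Complex.measurableEquivRealProd_apply, Complex.sq_norm, Complex.normSq_apply]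
  ring_nf

/-- Compact support of `(x, t) ↦ g(σ + |x|² + t²)` on `ℂ × ℝ` when `g` vanishes on `[R, ∞)`. [folklore] -/
private theorem hasCompactSupport_comp_add_sq_norm_add_sq (g : ℝ → ℝ) {R : ℝ} (hgR : ∀ u, R ≤ u → g u = 0) (σ : ℝ) :
    HasCompactSupport fun p : ℂ × ℝ => g (σ + ‖p.1‖ ^ 2 + p.2 ^ 2) := by
  refine HasCompactSupport.intro (K := closedBall (0 : ℂ × ℝ) (|R - σ| + 1)) (isCompact_closedBall _ _) fun p hp => ?_
  have hp' : |R - σ| + 1 < ‖p‖ := by simpa [mem_closedBall, dist_zero_right] using hp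
  have h1 : 1 ≤ |R - σ| + 1 := by linarith [abs_nonneg (R - σ)]
  apply hgR
  rw [Prod.norm_def] at hp'
  rcases lt_max_iff.1 hp' with h | h
  · have : ‖p.1‖ ≤ ‖p.1‖ ^ 2 := by nlinarith
    nlinarith [le_abs_self (R - σ), sq_nonneg p.2]
  · rw [Real.norm_eq_abs] at h
    have : |p.2| ≤ p.2 ^ 2 := by nlinarith [sq_abs p.2]
    nlinarith [le_abs_self (R - σ), sq_abs p.2, norm_nonneg p.1]

/-- **(P2) THE THREE-DIMENSIONAL SHELL INTEGRAL THROUGH THE PLANAR IDENTITY**: `∫_{ℂ×ℝ} g(σ + |x|² + t²) = π ∫_ℝ ∫_{σ+t²}^∞ g(u) du dt`. [folklore]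
[cite: Helgason2000, Ch. I §2] -/
theorem integral_comp_add_sq_norm_add_sq (g : ℝ → ℝ) (hg : Continuous g) {R : ℝ} (hgR : ∀ u, R ≤ u → g u = 0) (σ : ℝ) :
    ∫ p : ℂ × ℝ, g (σ + ‖p.1‖ ^ 2 + p.2 ^ 2) = π * ∫ t : ℝ, ∫ u in Ioi (σ + t ^ 2), g u := by
  have hc : Continuous fun p : ℂ × ℝ => g (σ + ‖p.1‖ ^ 2 + p.2 ^ 2) := by fun_prop
  have hint : Integrable (fun p : ℂ × ℝ => g (σ + ‖p.1‖ ^ 2 + p.2 ^ 2)) ((volume : Measure ℂ).prod volume) :=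
    hc.integrable_of_hasCompactSupport (hasCompactSupport_comp_add_sq_norm_add_sq g hgR σ)
  rw [show (volume : Measure (ℂ × ℝ)) = (volume : Measure ℂ).prod volume from rfl, integral_prod_symm _ hint]
  have hin : ∀ t : ℝ, ∫ x : ℂ, g (σ + ‖x‖ ^ 2 + t ^ 2) = π * ∫ u in Ioi (σ + t ^ 2), g u := fun t => by
    rw [← integral_comp_add_sq_norm_complex g hg hgR (σ + t ^ 2)]
    refine integral_congr_ae (Filter.Eventually.of_forall fun x => ?_)
    ring_nf
  simp_rw [hin]
  exact integral_const_mul _ _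

/-- `∫_a^∞ G′ = −G(a)` for differentiable `G` with continuous derivative vanishing, with `G`, on `[R, ∞)`. [folklore] -/
private theorem integral_Ioi_deriv_eq_neg_of_eq_zero_of_le {G : ℝ → ℝ} (hG : Differentiable ℝ G) (hG' : Continuous (deriv G)) {R : ℝ}
    (hGR : ∀ u, R ≤ u → G u = 0) (a : ℝ) : ∫ u in Ioi a, deriv G u = -G a := by
  have hder0 : ∀ u, R + 1 ≤ u → deriv G u = 0 := fun u hu => by
    have hev : G =ᶠ[𝓝 u] fun _ => (0 : ℝ) := by
      filter_upwards [Ioi_mem_nhds (show R < u by linarith)] with s hs using hGR s (le_of_lt hs)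
    rw [hev.deriv_eq, deriv_const]
  have hint : IntegrableOn (deriv G) (Ioi a) := (integrableOn_Ici_of_eq_zero_of_le hG' hder0 a).mono_set Ioi_subset_Ici_self
  have hlim : Tendsto G atTop (𝓝 0) := by
    refine tendsto_const_nhds.congr' ?_
    filter_upwards [eventually_ge_atTop R] with u hu using (hGR u hu).symm
  rw [integral_Ioi_of_hasDerivAt_of_tendsto (hG.continuous.continuousWithinAt) (fun x _ => (hG x).hasDerivAt) hint hlim]
  ring

/-- **(P2) for a derivative**: `∫_{ℂ×ℝ} G′(σ + |x|² + t²) = −π ∫_ℝ G(σ + t²) dt`. [folklore] [cite: Helgason2000, Ch. I §2] -/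
theorem integral_comp_add_sq_norm_add_sq_deriv {G : ℝ → ℝ} (hG : Differentiable ℝ G) (hG' : Continuous (deriv G)) {R : ℝ}
    (hGR : ∀ u, R ≤ u → G u = 0) (hG'R : ∀ u, R ≤ u → deriv G u = 0) (σ : ℝ) :
    ∫ p : ℂ × ℝ, deriv G (σ + ‖p.1‖ ^ 2 + p.2 ^ 2) = -π * ∫ t : ℝ, G (σ + t ^ 2) := by
  rw [integral_comp_add_sq_norm_add_sq (deriv G) hG' hG'R σ]
  simp_rw [integral_Ioi_deriv_eq_neg_of_eq_zero_of_le hG hG' hGR]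
  rw [integral_neg]
  ring

end Planar

/-! ## §2 The shell-null profile -/

section Profile

/-- Compact support of `(v, t) ↦ g(σ + v² + t²)` on `ℝ × ℝ` when `g` vanishes on `[R, ∞)`. [folklore] -/
private theorem hasCompactSupport_comp_add_sq_add_sq_real_prod (g : ℝ → ℝ) {R : ℝ} (hgR : ∀ u, R ≤ u → g u = 0) (σ : ℝ) :
    HasCompactSupport fun z : ℝ × ℝ => g (σ + z.1 ^ 2 + z.2 ^ 2) := by
  refine HasCompactSupport.intro (K := closedBall (0 : ℝ × ℝ) (|R| + |σ| + 1)) (isCompact_closedBall _ _) fun z hz => ?_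
  have hz' : |R| + |σ| + 1 < ‖z‖ := by simpa [mem_closedBall, dist_zero_right] using hz
  apply hgR
  have h1 : 1 ≤ |R| + |σ| + 1 := by linarith [abs_nonneg R, abs_nonneg σ]
  have hRσ : R ≤ σ + (|R| + |σ| + 1) := by linarith [le_abs_self R, neg_abs_le σ]
  rw [Prod.norm_def] at hz'
  simp only [Real.norm_eq_abs] at hz'
  rcases lt_max_iff.1 hz' with h | h
  · have h2 : |R| + |σ| + 1 < z.1 ^ 2 := by nlinarith [abs_nonneg z.1, sq_abs z.1]
    linarith [sq_nonneg z.2]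
  · have h2 : |R| + |σ| + 1 < z.2 ^ 2 := by nlinarith [abs_nonneg z.2, sq_abs z.2]
    linarith [sq_nonneg z.1]

/-- Compact support of `((x, t), v) ↦ g((σ + v²) + |x|² + t²)` on `(ℂ × ℝ) × ℝ` when `g` vanishes on `[R, ∞)`. [folklore] -/
private theorem hasCompactSupport_comp_add_sq_add_sq_norm_add_sq (g : ℝ → ℝ) {R : ℝ} (hgR : ∀ u, R ≤ u → g u = 0) (σ : ℝ) :
    HasCompactSupport fun q : (ℂ × ℝ) × ℝ => g ((σ + q.2 ^ 2) + ‖q.1.1‖ ^ 2 + q.1.2 ^ 2) := by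
  refine HasCompactSupport.intro (K := closedBall (0 : (ℂ × ℝ) × ℝ) (|R| + |σ| + 1)) (isCompact_closedBall _ _) fun q hq => ?_
  have hq' : |R| + |σ| + 1 < ‖q‖ := by simpa [mem_closedBall, dist_zero_right] using hq
  apply hgR
  have h1 : 1 ≤ |R| + |σ| + 1 := by linarith [abs_nonneg R, abs_nonneg σ]
  have hRσ : R ≤ σ + (|R| + |σ| + 1) := by linarith [le_abs_self R, neg_abs_le σ]
  rw [Prod.norm_def, Prod.norm_def] at hq'
  simp only [Real.norm_eq_abs] at hq'
  rcases lt_max_iff.1 hq' with h | h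
  · rcases lt_max_iff.1 h with h' | h'
    · have h2 : |R| + |σ| + 1 < ‖q.1.1‖ ^ 2 := by nlinarith [norm_nonneg q.1.1]
      linarith [sq_nonneg q.1.2, sq_nonneg q.2]
    · have h2 : |R| + |σ| + 1 < q.1.2 ^ 2 := by nlinarith [abs_nonneg q.1.2, sq_abs q.1.2]
      linarith [sq_nonneg q.2, sq_nonneg ‖q.1.1‖]
  · have h2 : |R| + |σ| + 1 < q.2 ^ 2 := by nlinarith [abs_nonneg q.2, sq_abs q.2]
    linarith [sq_nonneg q.1.2, sq_nonneg ‖q.1.1‖]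

/-- Off the closed ball of a bump, the bump and its first two derivatives vanish. [folklore] -/
private theorem bump_derivs_eq_zero_of_notMem {c : ℝ} (b : ContDiffBump c) {s : ℝ} (hs : s ∉ Icc (c - b.rOut) (c + b.rOut)) :
    (b : ℝ → ℝ) s = 0 ∧ deriv (b : ℝ → ℝ) s = 0 ∧ deriv (deriv (b : ℝ → ℝ)) s = 0 := by
  have hts : tsupport (b : ℝ → ℝ) = Icc (c - b.rOut) (c + b.rOut) := by rw [b.tsupport_eq, Real.closedBall_eq_Icc]
  have h0 : s ∉ tsupport (b : ℝ → ℝ) := by rwa [hts]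
  have h1sub : tsupport (deriv (b : ℝ → ℝ)) ⊆ tsupport (b : ℝ → ℝ) :=
    closure_minimal support_deriv_subset (isClosed_tsupport _)
  have h1 : s ∉ tsupport (deriv (b : ℝ → ℝ)) := fun h => h0 (h1sub h)
  refine ⟨image_eq_zero_of_notMem_tsupport h0, ?_, ?_⟩
  · exact Function.notMem_support.1 fun h => h0 (support_deriv_subset h)
  · exact Function.notMem_support.1 fun h => h1 (support_deriv_subset h)

/-- **`∫_ℝ Φ₀″(v²) dv = ¾ ∫ Φ₀(v²) v⁻⁴ dv > 0`** for a non-negative `C²` function supported in `[a, b] ⊂ (0, ∞)` and positive somewhere inside: on `v ≠ 0`,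
`Φ₀″(v²) = (d∕dv)[Φ₀′(v²)∕(2v) + Φ₀(v²)∕(4v³)] + ¾ Φ₀(v²)∕v⁴`. [cite: SamkoKilbasMarichev1993, §2.3 (2.21)] -/
theorem integral_deriv_deriv_comp_sq_pos {Φ₀ : ℝ → ℝ} (hΦ₀ : ContDiff ℝ ∞ Φ₀) (hnn : ∀ s, 0 ≤ Φ₀ s) {a b : ℝ} (ha : 0 < a)
    (hzero : ∀ s, s ∉ Icc a b → Φ₀ s = 0 ∧ deriv Φ₀ s = 0 ∧ deriv (deriv Φ₀) s = 0) {c : ℝ} (hc : c ∈ Icc a b) (hpos : 0 < Φ₀ c) :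
    0 < ∫ v, deriv (deriv Φ₀) (v ^ 2) := by
  set Φ₁ : ℝ → ℝ := deriv Φ₀ with hΦ₁
  set Φ₂ : ℝ → ℝ := deriv Φ₁ with hΦ₂
  have hΦ₁s : ContDiff ℝ ∞ Φ₁ := by rw [hΦ₁]; exact hΦ₀.iterate_deriv 1
  have hΦ₂s : ContDiff ℝ ∞ Φ₂ := by rw [hΦ₂]; exact hΦ₁s.iterate_deriv 1
  have hΦ₀d : Differentiable ℝ Φ₀ := hΦ₀.differentiable (by simp)
  have hΦ₁d : Differentiable ℝ Φ₁ := hΦ₁s.differentiable (by simp)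
  have hab : a ≤ b := hc.1.trans hc.2
  have hb0 : 0 < b := ha.trans_le hab
  -- endpoints `0 < a″`, `a″² < a`, `b < b″²`
  set a'' : ℝ := min (a / 2) (1 / 2) with ha''
  set b'' : ℝ := b + 1 with hb''
  have ha''pos : 0 < a'' := lt_min (by linarith) (by norm_num)
  have ha''sq : a'' ^ 2 < a := by
    have h1 : a'' ≤ 1 / 2 := min_le_right _ _
    have h2 : a'' ≤ a / 2 := min_le_left _ _
    nlinarith
  have hb''sq : b < b'' ^ 2 := by rw [hb'']; nlinarith
  have hab'' : a'' < b'' := by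
    have : a'' ≤ a / 2 := min_le_left _ _
    linarith
  have hvan_small : ∀ v, v ^ 2 ≤ a'' ^ 2 → Φ₀ (v ^ 2) = 0 ∧ Φ₁ (v ^ 2) = 0 ∧ Φ₂ (v ^ 2) = 0 := fun v hv =>
    hzero _ fun h => by linarith [h.1]
  have hvan_large : ∀ v, b'' ^ 2 ≤ v ^ 2 → Φ₀ (v ^ 2) = 0 ∧ Φ₁ (v ^ 2) = 0 ∧ Φ₂ (v ^ 2) = 0 := fun v hv =>
    hzero _ fun h => by linarith [h.2]
  -- the primitive `P(v) = Φ₁(v²)∕(2v) + Φ₀(v²)∕(4v³)` on `v ≠ 0`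
  have hP : ∀ v : ℝ, v ≠ 0 → HasDerivAt (fun v => Φ₁ (v ^ 2) / (2 * v) + Φ₀ (v ^ 2) / (4 * v ^ 3))
      (Φ₂ (v ^ 2) - 3 / 4 * (Φ₀ (v ^ 2) / v ^ 4)) v := fun v hv => by
    have hsq : HasDerivAt (fun v : ℝ => v ^ 2) (2 * v) v := by
      simpa using hasDerivAt_pow 2 v
    have h1 : HasDerivAt (fun v => Φ₁ (v ^ 2)) (Φ₂ (v ^ 2) * (2 * v)) v := by
      have := (hΦ₁d (v ^ 2)).hasDerivAt.comp v hsq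
      simpa [Function.comp_def, hΦ₂] using this
    have h0 : HasDerivAt (fun v => Φ₀ (v ^ 2)) (Φ₁ (v ^ 2) * (2 * v)) v := by
      have := (hΦ₀d (v ^ 2)).hasDerivAt.comp v hsq
      simpa [Function.comp_def, hΦ₁] using this
    have hd1 : HasDerivAt (fun v : ℝ => 2 * v) 2 v := by simpa using (hasDerivAt_id v).const_mul 2
    have hd3 : HasDerivAt (fun v : ℝ => 4 * v ^ 3) (12 * v ^ 2) v := by
      have := (hasDerivAt_pow 3 v).const_mul 4
      simpa using this.congr_deriv (by push_cast; ring)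
    have hA := h1.div hd1 (by positivity)
    have hB := h0.div hd3 (by positivity)
    refine (hA.add hB).congr_deriv ?_
    have h2v : (2 * v) ^ 2 ≠ 0 := by positivity
    have h4v : (4 * v ^ 3) ^ 2 ≠ 0 := by positivity
    have hv4 : v ^ 4 ≠ 0 := by positivity
    rw [div_add_div _ _ h2v h4v, div_eq_iff (mul_ne_zero h2v h4v)]
    field_simp
    ring
  have hcontΦ₂sq : Continuous fun v : ℝ => Φ₂ (v ^ 2) := hΦ₂s.continuous.comp (by fun_prop)
  have hcont_quot : ContinuousOn (fun v : ℝ => Φ₀ (v ^ 2) / v ^ 4) (Icc a'' b'') := by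
    refine ContinuousOn.div (hΦ₀.continuous.comp (by fun_prop)).continuousOn (by fun_prop) fun v hv => ?_
    have : 0 < v := ha''pos.trans_le hv.1
    positivity
  -- `∫_{a″}^{b″} (Φ₂(v²) − ¾ Φ₀(v²)∕v⁴) dv = P(b″) − P(a″) = 0`
  have hFTC : ∫ v in a''..b'', (Φ₂ (v ^ 2) - 3 / 4 * (Φ₀ (v ^ 2) / v ^ 4)) = 0 := by
    rw [intervalIntegral.integral_eq_sub_of_hasDerivAt
      (fun v hv => hP v (by rw [uIcc_of_le hab''.le] at hv; exact (ha''pos.trans_le hv.1).ne')) ?_]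
    · have e1 : (Φ₁ (b'' ^ 2) / (2 * b'') + Φ₀ (b'' ^ 2) / (4 * b'' ^ 3)) = 0 := by
        simp [(hvan_large b'' le_rfl).1, (hvan_large b'' le_rfl).2.1]
      have e2 : (Φ₁ (a'' ^ 2) / (2 * a'') + Φ₀ (a'' ^ 2) / (4 * a'' ^ 3)) = 0 := by
        simp [(hvan_small a'' le_rfl).1, (hvan_small a'' le_rfl).2.1]
      rw [e1, e2, sub_zero]
    · refine ContinuousOn.intervalIntegrable ?_
      rw [uIcc_of_le hab''.le]
      exact hcontΦ₂sq.continuousOn.sub (continuousOn_const.mul hcont_quot)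
  have hI1 : ∫ v in a''..b'', Φ₂ (v ^ 2) = 3 / 4 * ∫ v in a''..b'', Φ₀ (v ^ 2) / v ^ 4 := by
    have hi1 : IntervalIntegrable (fun v : ℝ => Φ₂ (v ^ 2)) volume a'' b'' := hcontΦ₂sq.intervalIntegrable _ _
    have hi2 : IntervalIntegrable (fun v : ℝ => 3 / 4 * (Φ₀ (v ^ 2) / v ^ 4)) volume a'' b'' := by
      refine ContinuousOn.intervalIntegrable ?_
      rw [uIcc_of_le hab''.le]
      exact continuousOn_const.mul hcont_quot
    rw [intervalIntegral.integral_sub hi1 hi2, intervalIntegral.integral_const_mul] at hFTC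
    linarith
  have hposI : 0 < ∫ v in a''..b'', Φ₀ (v ^ 2) / v ^ 4 := by
    have hc0 : 0 < c := ha.trans_le hc.1
    refine intervalIntegral.integral_pos hab'' hcont_quot (fun v _ => div_nonneg (hnn _) (by positivity)) ⟨Real.sqrt c, ?_, ?_⟩
    · constructor
      · refine (Real.le_sqrt' ha''pos).2 ?_
        linarith [hc.1]
      · rw [Real.sqrt_le_left (by linarith)]
        nlinarith [hc.2]
    · rw [Real.sq_sqrt hc0.le]
      positivity
  -- assemble: `∫_ℝ Φ₂(v²) = ∫_{−b″}^{−a″} + ∫_{−a″}^{a″} + ∫_{a″}^{b″}`, the middle term vanishes, the outer two agree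
  have hsupp : Function.support (fun v : ℝ => Φ₂ (v ^ 2)) ⊆ Ioc (-b'') b'' := by
    intro v hv
    rw [Function.mem_support] at hv
    have hlt : v ^ 2 < b'' ^ 2 := by
      by_contra h
      exact hv (hvan_large v (le_of_not_gt h)).2.2
    have hb''pos : 0 < b'' := by linarith
    have habs : |v| < b'' := abs_lt_of_sq_lt_sq' hlt hb''pos.le |>.elim fun h1 h2 => abs_lt.2 ⟨h1, h2⟩
    exact ⟨by linarith [neg_abs_le v, (abs_lt.1 habs).1], (abs_lt.1 habs).2.le⟩
  show 0 < ∫ v, Φ₂ (v ^ 2)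
  rw [← intervalIntegral.integral_eq_integral_of_support_subset hsupp]
  have hii : ∀ x y : ℝ, IntervalIntegrable (fun v : ℝ => Φ₂ (v ^ 2)) volume x y := fun x y => hcontΦ₂sq.intervalIntegrable _ _
  rw [← intervalIntegral.integral_add_adjacent_intervals (hii (-b'') (-a'')) (hii (-a'') b''),
    ← intervalIntegral.integral_add_adjacent_intervals (hii (-a'') a'') (hii a'' b'')]
  have hmid : ∫ v in (-a'')..a'', Φ₂ (v ^ 2) = 0 := by
    rw [intervalIntegral.integral_congr (g := fun _ => (0 : ℝ)) fun v hv => ?_]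
    · simp
    · rw [uIcc_of_le (by linarith)] at hv
      have : v ^ 2 ≤ a'' ^ 2 := by nlinarith [hv.1, hv.2, abs_le.2 ⟨hv.1, hv.2⟩, sq_abs v]
      exact (hvan_small v this).2.2
  have hleft : ∫ v in (-b'')..(-a''), Φ₂ (v ^ 2) = ∫ v in a''..b'', Φ₂ (v ^ 2) := by
    rw [← intervalIntegral.integral_comp_neg]
    simp
  rw [hmid, hleft, hI1]
  linarith

/-- **THE SHELL INTEGRALS OF `u ↦ ∫_ℝ Φ₀″(u + v²) dv` ARE `π² Φ₀(σ)`** — (P2) for `Φ₀″ = (Φ₀′)′` in `(x, t)`, Fubini in `v`, (P1) on `ℝ × ℝ` for `Φ₀′`, for a `C^∞`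
function `Φ₀` vanishing with its first two derivatives on `[R, ∞)`. [cite: SamkoKilbasMarichev1993, §2.3 (2.21)] [cite: Helgason2000, Ch. I §2] -/
theorem integral_shell_fibre_deriv_deriv_eq {Φ₀ : ℝ → ℝ} (hΦ₀ : ContDiff ℝ ∞ Φ₀) {R : ℝ}
    (hΦ₀R : ∀ u, R ≤ u → Φ₀ u = 0) (hΦ₁R : ∀ u, R ≤ u → deriv Φ₀ u = 0) (hΦ₂R : ∀ u, R ≤ u → deriv (deriv Φ₀) u = 0) (σ : ℝ) :
    ∫ p : ℂ × ℝ, ∫ v : ℝ, deriv (deriv Φ₀) ((σ + v ^ 2) + ‖p.1‖ ^ 2 + p.2 ^ 2) = π ^ 2 * Φ₀ σ := by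
  set Φ₁ : ℝ → ℝ := deriv Φ₀ with hΦ₁
  set Φ₂ : ℝ → ℝ := deriv Φ₁ with hΦ₂
  have hΦ₁s : ContDiff ℝ ∞ Φ₁ := by rw [hΦ₁]; exact hΦ₀.iterate_deriv 1
  have hΦ₂s : ContDiff ℝ ∞ Φ₂ := by rw [hΦ₂]; exact hΦ₁s.iterate_deriv 1
  have hΦ₀d : Differentiable ℝ Φ₀ := hΦ₀.differentiable (by simp)
  have hΦ₁d : Differentiable ℝ Φ₁ := hΦ₁s.differentiable (by simp)
  -- Fubini on `(ℂ × ℝ) × ℝ`: the joint integrand is continuous with compact support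
  have hF : Continuous fun q : (ℂ × ℝ) × ℝ => Φ₂ ((σ + q.2 ^ 2) + ‖q.1.1‖ ^ 2 + q.1.2 ^ 2) := hΦ₂s.continuous.comp (by fun_prop)
  have hFint : Integrable (fun q : (ℂ × ℝ) × ℝ => Φ₂ ((σ + q.2 ^ 2) + ‖q.1.1‖ ^ 2 + q.1.2 ^ 2))
      ((volume : Measure (ℂ × ℝ)).prod volume) :=
    hF.integrable_of_hasCompactSupport (hasCompactSupport_comp_add_sq_add_sq_norm_add_sq Φ₂ hΦ₂R σ)
  have hfub : ∫ p : ℂ × ℝ, ∫ v : ℝ, Φ₂ ((σ + v ^ 2) + ‖p.1‖ ^ 2 + p.2 ^ 2) = ∫ v : ℝ, ∫ p : ℂ × ℝ, Φ₂ ((σ + v ^ 2) + ‖p.1‖ ^ 2 + p.2 ^ 2) := by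
    have h1 := integral_prod _ hFint
    have h2 := integral_prod_symm _ hFint
    dsimp only at h1 h2
    rw [← h1, ← h2]
  rw [hfub]
  -- inner `(x, t)`-integral by (P2) for the derivative `Φ₂ = Φ₁′`
  have hin : ∀ v : ℝ, ∫ p : ℂ × ℝ, Φ₂ ((σ + v ^ 2) + ‖p.1‖ ^ 2 + p.2 ^ 2) = -π * ∫ t : ℝ, Φ₁ ((σ + v ^ 2) + t ^ 2) := fun v =>
    integral_comp_add_sq_norm_add_sq_deriv hΦ₁d hΦ₂s.continuous hΦ₁R hΦ₂R _
  simp_rw [hin]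
  rw [integral_const_mul]
  -- merge the `(v, t)` integrals and apply (P1) on `ℝ × ℝ` to `Φ₁ = Φ₀′`
  have hG : Continuous fun z : ℝ × ℝ => Φ₁ (σ + z.1 ^ 2 + z.2 ^ 2) := hΦ₁s.continuous.comp (by fun_prop)
  have hGint : Integrable (fun z : ℝ × ℝ => Φ₁ (σ + z.1 ^ 2 + z.2 ^ 2)) ((volume : Measure ℝ).prod volume) :=
    hG.integrable_of_hasCompactSupport (hasCompactSupport_comp_add_sq_add_sq_real_prod Φ₁ hΦ₁R σ)
  have hmerge : ∫ v : ℝ, ∫ t : ℝ, Φ₁ ((σ + v ^ 2) + t ^ 2) = ∫ z : ℝ × ℝ, Φ₁ (σ + z.1 ^ 2 + z.2 ^ 2) := by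
    have h1 := integral_prod _ hGint
    dsimp only at h1
    exact h1.symm
  rw [hmerge, integral_comp_add_sq_add_sq_real_prod Φ₁ hΦ₁s.continuous hΦ₁R σ, hΦ₁,
    integral_Ioi_deriv_eq_neg_of_eq_zero_of_le hΦ₀d (by rw [← hΦ₁]; exact hΦ₁s.continuous) hΦ₀R σ]
  ring

/-- **(P3) SHELL-NULL PROFILES EXIST.**  For `0 < ε < R` there is `β ∈ C^∞_c(ℝ)` with `β(u) = 0` for `u ≥ R`, `β(0) > 0`, and
`∫_{ℂ×ℝ} β(σ + |x|² + t²) dx dt = 0` for every `0 ≤ σ < ε` — the profile `β(u) = ∫_ℝ Φ₀″(u + v²) dv` of a bump `Φ₀ ∈ C_c^∞((ε, R))`: the shell integral is `π² Φ₀(σ)`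
(`integral_shell_fibre_deriv_deriv_eq`), and `β(0) = ¾ ∫ Φ₀(v²) v⁻⁴ dv > 0` (`integral_deriv_deriv_comp_sq_pos`). [cite: SamkoKilbasMarichev1993, §2.3 (2.21); §5.1] -/
theorem exists_contDiff_shellNullProfile {ε R : ℝ} (hε : 0 < ε) (hεR : ε < R) :
    ∃ β : ℝ → ℝ, ContDiff ℝ ∞ β ∧ HasCompactSupport β ∧ (∀ u, R ≤ u → β u = 0) ∧ 0 < β 0 ∧
      ∀ σ, 0 ≤ σ → σ < ε → ∫ p : ℂ × ℝ, β (σ + ‖p.1‖ ^ 2 + p.2 ^ 2) = 0 := by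
  -- the bump `Φ₀` on `(ε, R)`: centre `c₀`, radii `δ∕2 < δ`, `[c₀ − δ, c₀ + δ] = [a, bb] ⊂ (ε, R)`
  set c₀ : ℝ := (ε + R) / 2 with hc₀
  set δ : ℝ := (R - ε) / 4 with hδ
  have hδpos : 0 < δ := by rw [hδ]; linarith
  let b : ContDiffBump c₀ := ⟨δ / 2, δ, by linarith, by linarith⟩
  set Φ₀ : ℝ → ℝ := fun s => b s with hΦ₀
  set Φ₂ : ℝ → ℝ := deriv (deriv Φ₀) with hΦ₂
  set a : ℝ := c₀ - δ with ha
  set bb : ℝ := c₀ + δ with hbb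
  have hεa : ε < a := by rw [ha, hc₀, hδ]; linarith
  have hbbR : bb < R := by rw [hbb, hc₀, hδ]; linarith
  have ha0 : 0 < a := hε.trans hεa
  have hrOut : b.rOut = δ := rfl
  have hzero : ∀ s, s ∉ Icc a bb → Φ₀ s = 0 ∧ deriv Φ₀ s = 0 ∧ Φ₂ s = 0 := fun s hs =>
    bump_derivs_eq_zero_of_notMem b (by rwa [hrOut])
  have hΦ₀s : ContDiff ℝ ∞ Φ₀ := b.contDiff
  have hΦ₂s : ContDiff ℝ ∞ Φ₂ := by rw [hΦ₂]; exact hΦ₀s.iterate_deriv 2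
  have hΦ₀nn : ∀ s, 0 ≤ Φ₀ s := fun s => b.nonneg
  have hΦ₀c₀ : Φ₀ c₀ = 1 := b.one_of_mem_closedBall (Metric.mem_closedBall_self b.rIn_pos.le)
  have hc₀mem : c₀ ∈ Icc a bb := ⟨by rw [ha]; linarith, by rw [hbb]; linarith⟩
  -- the cut-off `ψ` in the fibre variable (≡ 1 on `|v| ≤ R + 2`)
  have hR0 : 0 < R := hε.trans hεR
  let bψ : ContDiffBump (0 : ℝ) := ⟨R + 2, R + 3, by linarith, by linarith⟩
  set ψ : ℝ → ℝ := fun v => bψ v with hψ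
  have hψ1 : ∀ v, v ^ 2 ≤ R + 1 → ψ v = 1 := fun v hv => by
    apply bψ.one_of_mem_closedBall
    rw [mem_closedBall, dist_zero_right, Real.norm_eq_abs]
    show |v| ≤ R + 2
    have h1 : v ^ 2 ≤ (R + 2) ^ 2 := by nlinarith
    exact abs_le_of_sq_le_sq' h1 (by linarith) |>.elim (fun h h' => abs_le.2 ⟨h, h'⟩)
  have hψ0 : ∀ v, R + 3 < |v| → ψ v = 0 := fun v hv =>
    bψ.zero_of_le_dist (by rw [dist_zero_right, Real.norm_eq_abs]; exact le_of_lt hv)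
  -- the profile and its support bookkeeping
  set H : ℝ → ℝ → ℝ := fun v u => ψ v * Φ₂ (u + v ^ 2) with hH
  have hHK : ∀ v u, u ∉ Icc (a - (R + 3) ^ 2) bb → H v u = 0 := fun v u hu => by
    simp only [hH]
    by_cases h2 : Φ₂ (u + v ^ 2) = 0
    · simp [h2]
    by_cases hψv : ψ v = 0
    · simp [hψv]
    exfalso
    have hv : |v| ≤ R + 3 := by
      by_contra h
      exact hψv (hψ0 v (lt_of_not_ge h))
    have hv2 : v ^ 2 ≤ (R + 3) ^ 2 := by
      have := abs_nonneg v
      nlinarith [sq_abs v]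
    have hmem : u + v ^ 2 ∈ Icc a bb := by
      by_contra h
      exact h2 (hzero _ h).2.2
    exact hu ⟨by linarith [hmem.1], by linarith [hmem.2, sq_nonneg v]⟩
  have hdrop : ∀ u, 0 ≤ u → ∀ v, H v u = Φ₂ (u + v ^ 2) := fun u hu v => by
    simp only [hH]
    by_cases h2 : Φ₂ (u + v ^ 2) = 0
    · simp [h2]
    have hmem : u + v ^ 2 ∈ Icc a bb := by
      by_contra h
      exact h2 (hzero _ h).2.2
    rw [hψ1 v (by linarith [hmem.2]), one_mul]
  refine ⟨fun u => ∫ v, H v u, ?_, ?_, ?_, ?_, ?_⟩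
  · -- smoothness: ★ compactly supported parametric integral
    refine Literature.Analysis.Calculus.contDiff_integral_of_support (μ := (volume : Measure ℝ)) (H := H)
      (fun v => by rw [hH]; fun_prop) (fun n => ?_) (C := closedBall (0 : ℝ) (R + 3)) (isCompact_closedBall _ _)
      (fun v hv u => ?_) (K := Icc (a - (R + 3) ^ 2) bb) isCompact_Icc hHK
    · -- the jets `(v, u) ↦ Dⁿ_u H v u = ψ v • (Dⁿ Φ₂)(u + v²)` are jointly continuous
      have hjet : (fun x : ℝ × ℝ => iteratedFDeriv ℝ n (H x.1) x.2) =
          fun x : ℝ × ℝ => ψ x.1 • iteratedFDeriv ℝ n Φ₂ (x.2 + x.1 ^ 2) := by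
        funext x
        have e1 : H x.1 = ψ x.1 • fun u => Φ₂ (u + x.1 ^ 2) := by funext u; simp [hH, smul_eq_mul]
        have hcd : ContDiff ℝ n (fun u : ℝ => Φ₂ (u + x.1 ^ 2)) :=
          (show ContDiff ℝ ∞ (fun u : ℝ => Φ₂ (u + x.1 ^ 2)) by fun_prop).of_le (by exact_mod_cast le_top)
        rw [e1, iteratedFDeriv_const_smul_apply hcd.contDiffAt, iteratedFDeriv_comp_add_right]
      rw [hjet]
      exact (bψ.continuous.comp continuous_fst).smul
        ((hΦ₂s.continuous_iteratedFDeriv (m := n) (by exact_mod_cast le_top)).comp (by fun_prop))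
    · have : ψ v = 0 := hψ0 v (by simpa [mem_closedBall, dist_zero_right] using hv)
      simp [hH, this]
  · -- compact support: the integrand vanishes identically for `u ∉ [a − (R+3)², bb]`
    refine HasCompactSupport.intro (K := Icc (a - (R + 3) ^ 2) bb) isCompact_Icc fun u hu => ?_
    simp [hHK _ u hu]
  · -- `β(u) = 0` for `u ≥ R`: `u + v² ≥ R > bb`
    intro u hu
    have : ∀ v, H v u = 0 := fun v => by
      have hnot : u + v ^ 2 ∉ Icc a bb := fun h => by linarith [h.2, sq_nonneg v]
      simp [hH, (hzero _ hnot).2.2]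
    simp [this]
  · -- `β(0) = ∫ Φ₀″(v²) dv > 0`
    have e0 : (fun v => H v 0) = fun v => Φ₂ (v ^ 2) := by
      funext v
      rw [hdrop 0 le_rfl v, zero_add]
    show 0 < ∫ v, H v 0
    rw [e0, hΦ₂]
    exact integral_deriv_deriv_comp_sq_pos hΦ₀s hΦ₀nn ha0 hzero hc₀mem (by rw [hΦ₀c₀]; norm_num)
  · -- the shell integrals vanish: `π² Φ₀(σ) = 0` for `σ < ε < a`
    intro σ hσ0 hσε
    have hbbR1 : ∀ u, bb + 1 ≤ u → u ∉ Icc a bb := fun u hu h => by linarith [h.2]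
    have hnn : ∀ p : ℂ × ℝ, 0 ≤ σ + ‖p.1‖ ^ 2 + p.2 ^ 2 := fun p => by positivity
    have e1 : (fun p : ℂ × ℝ => ∫ v, H v (σ + ‖p.1‖ ^ 2 + p.2 ^ 2)) =
        fun p : ℂ × ℝ => ∫ v, Φ₂ ((σ + v ^ 2) + ‖p.1‖ ^ 2 + p.2 ^ 2) := by
      funext p
      refine integral_congr_ae (Filter.Eventually.of_forall fun v => ?_)
      simp only [hdrop _ (hnn p)]
      ring_nf
    show (∫ p : ℂ × ℝ, ∫ v, H v (σ + ‖p.1‖ ^ 2 + p.2 ^ 2)) = 0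
    rw [e1, hΦ₂, integral_shell_fibre_deriv_deriv_eq hΦ₀s (fun u hu => (hzero u (hbbR1 u hu)).1)
      (fun u hu => (hzero u (hbbR1 u hu)).2.1) (fun u hu => (hzero u (hbbR1 u hu)).2.2) σ]
    have hΦ₀σ : Φ₀ σ = 0 := (hzero σ fun h => by linarith [h.1]).1
    rw [hΦ₀σ, mul_zero]

end Profile

end Literature.Analysis.SpecialFunctions

end
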